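import Literature.NumberTheory.EllipticCurves.HeegnerPointsGaloisDescent
import Literature.NumberTheory.EllipticCurves.ModularParametrizationLeavesProofs
import HarnessLib

/-!
# `exists_isHeegnerPoint`: the target fact from exactly its open named inputs

The named fact `Literature.NumberTheory.EllipticCurves.exists_isHeegnerPoint W K`
(`HeegnerPoints.lean`; Gross–Zagier 1986, I.§4: for a globally minimal elliptic `W/ℚ` of
conductor `N_E` and an imaginary quadratic `K` in which every `p ∣ N_E` splits, some `P ∈ E(K)`
is a Heegner point of level `N_E`) is decomposed in `HeegnerPointsRationality.lean` into four
leaves; `HeegnerPointsGaloisDescent.lean` splits the CM leaf into the Galois-stability of the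
Heegner points over the Hilbert class field (named fact `heegnerPoints_galoisConj`) and the
descent of the trace (proved); `ModularParametrizationLeavesProofs.lean` reduces the Modularity
leaf `nonempty_modularParametrizationData` to modularity "Version `a_p`" and the three inputs of
"(2) ⇒ (6)" of Breuil–Conrad–Diamond–Taylor 2001, p. 845. This file (theorems only) composes the
two reductions, so that the tree states the target as a consequence of **exactly** its five open
named inputs, every other step (Heegner condition, existence and independence of Heegner data,
Néron lattice, uniformisation `ℂ/Λ ≅ E(ℂ)`, modular degree, Galois descent of the trace) being a
theorem of the tree:

1. `exists_isNewformOf` — the Modularity theorem, BCDT 2001 Thm. A in the form (2);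
2. `eichlerShimuraConstruction` — Knapp 1993, Thm. 11.74 (Eichler–Shimura) with Thm. 12.8;
3. `WeierstrassCurve.isIsogenous_iff_frobeniusTrace_eq` — Faltings' isogeny theorem;
4. `neronLattice_commensurable_of_isIsogenous` — Silverman AEC VI.4.1/VI.5.3 with III.5;
5. `heegnerPoints_galoisConj` — complex multiplication and Shimura reciprocity, Darmon 2004
   Thms. 3.6–3.7; Gross 1991, §1.

Nothing is weakened: the conclusion is literally `exists_isHeegnerPoint W K`.

## Design notes

* Theorems only; no new definitions. The file sits above both reduction files in the import
  graph (it is the only module importing `ModularParametrizationLeavesProofs` together with the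
  Heegner-point files), so neither reduction acquires the other's imports.
* Cross-reference (review of p15306): the Galois descent used in `HeegnerPointsGaloisDescent.lean`
  (`exists_map_eq_of_forall_map_galois_eq`: model over `ℚ`, any Galois `L/k`) has as nearest
  neighbour in the tree `WeierstrassCurve.Affine.Point.exists_map_ofId_eq_of_forall_map_algEquiv_eq`
  (`WeakMordellWeilReduction.lean`: model over `K`, finite Galois `L/K`), besides
  `WeierstrassCurve.fixedPoints_eq_range_map_holds` (`GaloisAction.lean`, `F̄/F`); the three are
  differently typed instances of `E(L)^{Gal(L/K)} = E(K)` (Silverman AEC VIII.§1).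

## References

* B. H. Gross, *Kolyvagin's work on modular elliptic curves*, in *`L`-functions and arithmetic*
  (Durham, 1989), LMS Lecture Note Ser. 153 (1991), 235–256, §1 (PDF pp. 212–213 of the held
  volume `book:editornd-l-functions-arithmetic`). [GrossLMS1991]
* H. Darmon, *Rational Points on Modular Elliptic Curves*, CBMS 101 (2004), Thm. 3.6, Thm. 3.7,
  §3.7 (held: `paper:doi-10-1090-cbms-101`, PDF pp. 43–44, 49). [Darmon2004]
* C. Breuil, B. Conrad, F. Diamond, R. Taylor, *On the modularity of elliptic curves over `ℚ`*,
  J. Amer. Math. Soc. 14 (2001), Thm. A; p. 845, (1)–(6). [BCDTJAMS2001]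
* B. H. Gross, D. B. Zagier, *Heegner points and derivatives of `L`-series*, Invent. Math. 84
  (1986), I.§4. [GrossZagier1986]
-/

noncomputable section

open Literature.NumberTheory.EllipticCurves.ModularForms

universe u

namespace Literature.NumberTheory.EllipticCurves

variable (W : WeierstrassCurve ℚ) (K : Type u) [Field K] [NumberField K]

/-- **`exists_isHeegnerPoint` from its five open named inputs.** For `W/ℚ` a globally minimal
elliptic curve of conductor `N_E` and `K` an imaginary quadratic field satisfying the Heegner
hypothesis for `N_E`, some `P ∈ E(K)` is a Heegner point of level `N_E`
(`exists_isHeegnerPoint W K`; Gross–Zagier 1986, I.§4; Gross 1991, §1: "`x₁` is rational over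
`K₁` … `y_K = Tr_{K₁/K}(y₁)` in `E(K)`"), granted: modularity "Version `a_p`"
(`exists_isNewformOf`), the Eichler–Shimura construction (`eichlerShimuraConstruction`),
Faltings' isogeny theorem (`WeierstrassCurve.isIsogenous_iff_frobeniusTrace_eq`), the
commensurability of the period lattices of `ℚ`-isogenous curves
(`neronLattice_commensurable_of_isIsogenous`) — together the Modularity leaf,
`nonempty_modularParametrizationData_of_leaves` — and the Galois-stability of the Heegner points
over the Hilbert class field at level `N_E` (`heegnerPoints_galoisConj`, Darmon 2004
Thms. 3.6–3.7), from which the CM leaf follows by the proved descent of the trace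
(`exists_isHeegnerPoint_of_modularity_of_galoisConj`). [cite: GrossLMS1991, §1 (pp. 235–236)] -/
theorem exists_isHeegnerPoint_of_leaves (h₁ : exists_isNewformOf)
    (hES : eichlerShimuraConstruction)
    (hF : WeierstrassCurve.isIsogenous_iff_frobeniusTrace_eq)
    (hI : neronLattice_commensurable_of_isIsogenous)
    (hCM : ∀ [NeZero (W.conductorNorm ℤ)], heegnerPoints_galoisConj (W.conductorNorm ℤ) W K) :
    exists_isHeegnerPoint W K :=
  exists_isHeegnerPoint_of_modularity_of_galoisConj W K
    (nonempty_modularParametrizationData_of_leaves h₁ hES hF hI) hCM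

end Literature.NumberTheory.EllipticCurves

end
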